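import Literature.Barriers.CriticalPhenomena.PlaquetteWalkHoleRootSealedDoors
import HarnessLib

/-!
# Barrier catalogue (SAWScalingLimit): THE SEALED POCKET — a dead end with one door UNCROSSED is still dead; a far door opening into a
two-cell pocket kills both routes and the vertex functional

Leaf of `PlaquetteWalkHoleRootSealedDoors` (`ΩG.WE_eq_excursionWinding_of_farW_side_uncrossed`: a far door no class-`B2a` walk can cross
kills both routes; cone: `ΩG.nth_ne_side_of_deadEnd`, `ΩG.faces_mem_of_nth`, `exists_arc_of_nth_eq`, `exists_excursion_arc_of_exit_eq`).
Setting: root plaquette `w` rooted at `W`, hole `holeFaceW w ∉ D`, far cell `farW w`, `farSW w = (w.1 − 2, w.2 − 1)`, `holeS = (w.1 − 1, w.2 − 1)`.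

The venture lane's kit completeness scan (b-step0 gen 30, j311932; FINDING-YB-KILL-FORCED-ZEROS §28 add. 9 (27)) found, at four removed
cells, the one emptiness that neither a corner cut nor a dead-end door explains: `pocketSW`, `farSWS`, `holeSS`, `rootS` absent seal
`{farSW, holeS}` into a TWO-CELL POCKET behind the far cell's south door — `holeS` is a dead end whose door leads into `farSW`, and
`farSW`'s other sides are dead. This file types the mechanism once and for all:

* §1 ★★★★ `ΩG.nth_ne_side_of_deadEnd_uncrossed` — the parent lineage's «dead ends are dead» with a PER-WALK hypothesis: a cell `g ≠ w`,
  `≠ farW w` each of whose sides other than `s` is dead OR never crossed by `ω` has `s` never crossed by `ω` either (an arc in `g`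
  ending at `s` has a second end). Chains of such cells peel pockets of any length.
* §2 ★★★★ `ΩG.WE_eq_excursionWinding_of_farSW_pocket2` — hole, `(w.1 − 3, w.2 − 1)`, `(w.1 − 2, w.2 − 2)`, `(w.1 − 1, w.2 − 2)` and
  `rootS w = (w.1, w.2 − 1)` absent ⇒ no wound walk of either route (in ANY domain: `holeS`, if present, is a dead end ⇒ `farSW.E`
  uncrossed ⇒ `farSW` peels ⇒ the far cell's south door uncrossed); ★★★★ the row mirror `…_of_farNW_pocket2` (`pocketNW`, `farNWN`,
  `holeNN`, `rootN`).
* §3 ★★★ `vertexFunctional_printed_eq_zero_of_farSW_pocket2` / `…farNW…` — `V ≡ 0` on `[π/3, 2π/3]` for every face list with the far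
  cell present and those cells absent: an identically-vanishing configuration of four cells (plus the hole) that needs no wall and
  seals no single door directly.

Not in print; venture lane «pcv-sawmu», seat b-step0 gen 30.

References: A. Glazman, Electron. Commun. Probab. 20 (2015) no. 86, Lemma 3.1, proof pp. 6–7 (the classes of walks through a rhombus)
[Glazman2015WeightedSAW]; A. Glazman, I. Manolescu, arXiv:1708.00395v3, §1 (Fig. 1: an arc joins two sides of its rhombus), §2.1,
Lemma 2.1 [GlazmanManolescu2019].
-/

noncomputable section

open Set Function Complex

namespace Literature.Probability.RandomPlanarGeometry.SAW.YangBaxter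

open Real

open private len_eq side_jOut from Literature.Probability.RandomPlanarGeometry.YangBaxterSAWExcursionJordan

namespace ΩG

variable {D : Set Face} {w : Face} {ω : ΩG D (w.side .W) (farW w)}

/-! ## §1 Dead ends with uncrossed doors -/

/-- ★★★★ **A DEAD END WITH UNCROSSED DOORS IS DEAD.** Let `g` be a cell other than the root plaquette `w` and the far cell, and `s` a side of
`g` such that every OTHER side of `g` is dead (a face absent) or is never a mid-edge of the class-`B2a` walk `ω` (indices `1 ≤ i ≤ length`).
Then `s` is never a mid-edge of `ω` either: an arc of `ω` in `g` ending at `s` would have a second end, crossed by `ω` and live.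
[cite: Glazman2015WeightedSAW, Lemma 3.1 (proof, pp. 6–7: the classes of walks through a rhombus)]
[cite: GlazmanManolescu2019, §1, Fig. 1 (an arc joins two sides of its rhombus)] -/
theorem nth_ne_side_of_deadEnd_uncrossed (hh : holeFaceW w ∉ D) (hr : RootedFace D (w.side .W) (farW w)) (h : ω.IsB2a)
    {g : Face} (hgw : g ≠ w) (hgf : g ≠ farW w) {s : Side}
    (hdead : ∀ t : Side, t ≠ s → ((g.side t).faces.1 ∉ D ∨ (g.side t).faces.2 ∉ D) ∨
      ∀ i, 1 ≤ i → i ≤ ω.2.arcs.length → ω.2.nth i ≠ g.side t) :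
    ∀ i, 1 ≤ i → i ≤ ω.2.arcs.length → ω.2.nth i ≠ g.side s := by
  intro i hi1 hi e
  have hF := ω.fh_lt h
  have hM := ω.three_le_Mv hr h
  have hlen : ω.2.arcs.length = ω.2.firstHitG + ω.Mv := len_eq h
  -- an arc of the walk in `g` with the end `s`
  obtain ⟨m, hmn, hfm, hs⟩ : ∃ m, m < ω.2.arcs.length ∧ ω.2.fc m = g ∧ (ω.2.sIn m = s ∨ ω.2.sOut m = s) := by
    rcases Nat.lt_or_ge i ω.2.arcs.length with hlt | hge
    · obtain ⟨m, hm, hfm, hs⟩ := exists_arc_of_nth_eq (ω := ω) hi1 hlt e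
      exact ⟨m, by rcases hm with em | em <;> omega, hfm, hs⟩
    · have heq : i = ω.2.arcs.length := by omega
      have hj : ω.Mv - 1 < ω.Mv := by omega
      have e' : (ω.jFace h (ω.Mv - 1)).side (ω.jOut hr h (ω.Mv - 1)) = g.side s := by
        rw [side_jOut (hr := hr) h hj, show ω.2.firstHitG + (ω.Mv - 1) + 1 = ω.2.arcs.length by omega, ← heq, e]
      obtain ⟨m, -, hmn, hfm, hs⟩ := exists_excursion_arc_of_exit_eq hr h hj hgf e'
      exact ⟨m, hmn, hfm, hs⟩
  -- its other end is a live side of `g`, crossed by `ω`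
  obtain ⟨hin, hout, hio⟩ := ω.2.side_sIn_nth (i := m) hmn
  rw [hfm] at hin hout
  have hm0 : m ≠ 0 := by
    intro hm0
    subst hm0
    exact hgw (hfm.symm.trans (fc_zero_eq_root (w := w) hh ω.2 (by omega)))
  rcases hs with hs | hs
  · have ht : ω.2.sOut m ≠ s := fun e2 => hio (hs.trans e2.symm)
    rcases hdead _ ht with hd | hun
    · have hl := faces_mem_of_nth hr h (j := m + 1) (by omega) (by omega)
      rw [← hout] at hl
      rcases hd with hd | hd
      · exact hd hl.1
      · exact hd hl.2
    · exact hun (m + 1) (by omega) (by omega) hout.symm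
  · have ht : ω.2.sIn m ≠ s := fun e2 => hio (e2.trans hs.symm)
    rcases hdead _ ht with hd | hun
    · have hl := faces_mem_of_nth hr h (j := m) (by omega) (by omega)
      rw [← hin] at hl
      rcases hd with hd | hd
      · exact hd hl.1
      · exact hd hl.2
    · exact hun m (by omega) (by omega) hin.symm

/-! ## §2 The two-cell pocket behind a far door -/

/-- ★★★★ **THE SEALED POCKET BELOW: `pocketSW`, `farSWS`, `holeSS`, `rootS` ABSENT ⇒ NO WOUND WALK OF EITHER ROUTE.** Hole,
`(w.1 − 3, w.2 − 1)`, `(w.1 − 2, w.2 − 2)`, `(w.1 − 1, w.2 − 2)` and `rootS w` absent; `holeS = (w.1 − 1, w.2 − 1)` may be present. Then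
`holeS` is a dead end whose only door is `farSW.E` (never crossed), `farSW` has its west and south sides dead and its east side uncrossed
(never crossed either: §1), so the far cell's south door is never crossed and no class-`B2a` walk is wound.
[cite: Glazman2015WeightedSAW, Lemma 3.1 (proof, pp. 6–7)] [cite: GlazmanManolescu2019, §1 (Fig. 1), Lemma 2.1] -/
theorem WE_eq_excursionWinding_of_farSW_pocket2 (hh : holeFaceW w ∉ D) (hP : ((w.1 - 3, w.2 - 1) : Face) ∉ D)
    (hF : ((w.1 - 2, w.2 - 2) : Face) ∉ D) (hHS : ((w.1 - 1, w.2 - 2) : Face) ∉ D) (hRS : rootS w ∉ D)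
    (ω : ΩG D (w.side .W) (farW w)) (hr : RootedFace D (w.side .W) (farW w)) (h : ω.IsB2a) (θ : ℝ) :
    ω.WE (fun _ => θ) = excursionWinding θ ω.2.firstSideG (ω.z1 hr h) ω.1 := by
  obtain ⟨a, b⟩ := w
  have e : (farW (a, b)).side .S = (farSW (a, b)).side .N := by
    simp only [farW, farSW, Face.side]; congr 1; ring
  refine WE_eq_excursionWinding_of_farW_side_uncrossed hh ω hr h (s := .S) (by decide) (fun i hi1 hi2 => ?_) θ
  rw [e]
  -- `holeS.W = farSW.E` is never crossed: `holeS` is a dead end (or absent)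
  have hE : ∀ j, 1 ≤ j → j ≤ ω.2.arcs.length → ω.2.nth j ≠ (farSW (a, b)).side .E := by
    by_cases hH : ((a - 1, b - 1) : Face) ∈ D
    · have e2 : (farSW (a, b)).side .E = Face.side ((a - 1, b - 1) : Face) .W := by
        simp only [farSW, Face.side]; congr 1; ring
      rw [e2]
      refine nth_ne_side_of_deadEnd hh hr h (g := ((a - 1, b - 1) : Face)) ?_ ?_ (fun t ht => ?_)
      · simp [Prod.ext_iff]
      · simp [farW, Prod.ext_iff]
      · cases t
        · exact absurd rfl ht
        · right; simpa [Face.side, MidEdge.faces, rootS, show a - 1 + 1 = a by ring] using hRS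
        · left; simpa [Face.side, MidEdge.faces, show b - 1 - 1 = b - 2 by ring] using hHS
        · right
          have eh : holeFaceW (a, b) = (a - 1, b) := by simp [holeFaceW]
          simpa [Face.side, MidEdge.faces, show b - 1 + 1 = b by ring, eh] using hh
    · exact nth_ne_of_faces_not_mem hr h (Or.inr (by simpa [farSW, Face.side, MidEdge.faces, show a - 2 + 1 = a - 1 by ring] using hH))
  refine nth_ne_side_of_deadEnd_uncrossed hh hr h (g := farSW (a, b)) ?_ ?_ (fun t ht => ?_) i hi1 hi2
  · simp [farSW, Prod.ext_iff]
  · simp [farSW, farW, Prod.ext_iff]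
  · cases t
    · left; left; simpa [farSW, Face.side, MidEdge.faces, show a - 2 - 1 = a - 3 by ring] using hP
    · right; exact hE
    · left; left; simpa [farSW, Face.side, MidEdge.faces, show b - 1 - 1 = b - 2 by ring] using hF
    · exact absurd rfl ht

/-- The reflection in the root row on a cell, in coordinates. [cite: GlazmanManolescu2019, §4.2 (lattice symmetries)] -/
private theorem mirrorRowFace_mkSP (w : Face) (x y : ℤ) :
    Literature.Barriers.CriticalPhenomena.PlaquetteWalk.mirrorRowFace w.2 ((x, y) : Face) = (x, 2 * w.2 - y) := by
  simp [Literature.Barriers.CriticalPhenomena.PlaquetteWalk.mirrorRowFace]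

/-- ★★★★ **THE SEALED POCKET ABOVE (row mirror): `pocketNW = (w.1 − 3, w.2 + 1)`, `farNWN = (w.1 − 2, w.2 + 2)`, `holeNN = (w.1 − 1, w.2 + 2)`,
`rootN w` ABSENT ⇒ NO WOUND WALK OF EITHER ROUTE.** [cite: GlazmanManolescu2019, §4.2 (lattice symmetries), Lemma 2.1]
[cite: Glazman2015WeightedSAW, Lemma 3.1 (proof, pp. 6–7)] -/
theorem WE_eq_excursionWinding_of_farNW_pocket2 (hh : holeFaceW w ∉ D) (hP : ((w.1 - 3, w.2 + 1) : Face) ∉ D)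
    (hF : ((w.1 - 2, w.2 + 2) : Face) ∉ D) (hHN : ((w.1 - 1, w.2 + 2) : Face) ∉ D) (hRN : rootN w ∉ D)
    (ω : ΩG D (w.side .W) (farW w)) (hr : RootedFace D (w.side .W) (farW w)) (h : ω.IsB2a) (θ : ℝ) :
    ω.WE (fun _ => θ) = excursionWinding θ ω.2.firstSideG (ω.z1 hr h) ω.1 := by
  by_contra hW
  have hr' := rootedFace_rowMirrorDom w hr
  have h' := ω.mirrorFar_isB2a hr h
  have hh' : holeFaceW w ∉ rowMirrorDom w D := by rwa [mem_rowMirrorDom, mirrorRowFace_holeFaceW]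
  have hP' : ((w.1 - 3, w.2 - 1) : Face) ∉ rowMirrorDom w D := by
    rw [mem_rowMirrorDom, mirrorRowFace_mkSP, show 2 * w.2 - (w.2 - 1) = w.2 + 1 by ring]; exact hP
  have hF' : ((w.1 - 2, w.2 - 2) : Face) ∉ rowMirrorDom w D := by
    rw [mem_rowMirrorDom, mirrorRowFace_mkSP, show 2 * w.2 - (w.2 - 2) = w.2 + 2 by ring]; exact hF
  have hHS' : ((w.1 - 1, w.2 - 2) : Face) ∉ rowMirrorDom w D := by
    rw [mem_rowMirrorDom, mirrorRowFace_mkSP, show 2 * w.2 - (w.2 - 2) = w.2 + 2 by ring]; exact hHN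
  have hRS' : rootS w ∉ rowMirrorDom w D := by rwa [mem_rowMirrorDom, mirrorRowFace_rootS]
  exact absurd (WE_eq_excursionWinding_of_farSW_pocket2 hh' hP' hF' hHS' hRS' ω.mirrorFar hr' h' _) (ω.mirrorFar_wound hr h hW)

end ΩG

end Literature.Probability.RandomPlanarGeometry.SAW.YangBaxter

namespace Literature.Barriers.CriticalPhenomena.PlaquetteWalk

open Literature.Probability.RandomPlanarGeometry.SAW.YangBaxter
open Real Complex

/-! ## §3 The vertex functional -/

section PocketVF

variable {Dl : List Face} {w : Face}

/-- ★★★ **THE SEALED POCKET BELOW ⇒ `V ≡ 0`** (far cell present; hole, `pocketSW`, `farSWS`, `holeSS`, `rootS` absent; any further defects).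
[cite: GlazmanManolescu2019, Lemma 2.1 (statement, "in the form given in [Gl]"), §1 eq. (1)] [cite: Glazman2015WeightedSAW, Lemma 3.1 (proof, pp. 6–7)] -/
theorem vertexFunctional_printed_eq_zero_of_farSW_pocket2 {θ : ℝ} (hθ : θ ∈ Set.Icc (π / 3) (2 * π / 3))
    (hf : farW w ∈ Dl) (hh : holeFaceW w ∉ dom Dl) (hP : ((w.1 - 3, w.2 - 1) : Face) ∉ dom Dl)
    (hF : ((w.1 - 2, w.2 - 2) : Face) ∉ dom Dl) (hHS : ((w.1 - 1, w.2 - 2) : Face) ∉ dom Dl) (hRS : rootS w ∉ dom Dl) :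
    vertexFunctional (printedWeights θ) tFiveEighths (ybCoeff θ) Dl (w.side .W) (farW w) = 0 :=
  vertexFunctional_printed_eq_zero_of_both_unwound hθ hf hh fun hr ω h =>
    ΩG.WE_eq_excursionWinding_of_farSW_pocket2 hh hP hF hHS hRS ω hr h θ

/-- ★★★ **THE SEALED POCKET ABOVE ⇒ `V ≡ 0`** (hole, `pocketNW`, `farNWN`, `holeNN`, `rootN` absent).
[cite: GlazmanManolescu2019, Lemma 2.1 (statement, "in the form given in [Gl]"), §1 eq. (1), §4.2] [cite: Glazman2015WeightedSAW, Lemma 3.1 (proof, pp. 6–7)] -/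
theorem vertexFunctional_printed_eq_zero_of_farNW_pocket2 {θ : ℝ} (hθ : θ ∈ Set.Icc (π / 3) (2 * π / 3))
    (hf : farW w ∈ Dl) (hh : holeFaceW w ∉ dom Dl) (hP : ((w.1 - 3, w.2 + 1) : Face) ∉ dom Dl)
    (hF : ((w.1 - 2, w.2 + 2) : Face) ∉ dom Dl) (hHN : ((w.1 - 1, w.2 + 2) : Face) ∉ dom Dl) (hRN : rootN w ∉ dom Dl) :
    vertexFunctional (printedWeights θ) tFiveEighths (ybCoeff θ) Dl (w.side .W) (farW w) = 0 :=
  vertexFunctional_printed_eq_zero_of_both_unwound hθ hf hh fun hr ω h =>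
    ΩG.WE_eq_excursionWinding_of_farNW_pocket2 hh hP hF hHN hRN ω hr h θ

end PocketVF

end Literature.Barriers.CriticalPhenomena.PlaquetteWalk
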